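import Summits.ResolutionOfSingularities.ResolutionOfSingularities.Theorems.FrobeniusLadderFInjectiveMacaulayficationProp44SigmaCurves
import Literature.AlgebraicGeometry.Resolution.EmbeddedCurveConfigurationPointBlowups
import Literature.AlgebraicGeometry.Resolution.StrictTransformGenericPoint
import Literature.AlgebraicGeometry.Resolution.BlowupExceptionalFibreNontrivial
import Literature.AlgebraicGeometry.Resolution.ExceptionalDivisorRegularGlobal
import Literature.AlgebraicGeometry.Resolution.BlowupChartMembership
import Literature.AlgebraicGeometry.Resolution.PointCentrePermissible
import Literature.AlgebraicGeometry.Resolution.FibreComponentsBaseChange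
import Literature.AlgebraicGeometry.Resolution.GenericPointStalkData
import HarnessLib

/-!
# [F-75c discharge, brick C1] One point blow-up of a configuration of curves on a regular surface: the
# members of the successor configuration (The Stacks Project, Lemma 54.15.6 = Tag 0BIC, proof ¶1)

Cell res-hironaka, D-0154 INPUTS discharger `res-inputs-p-f75c` for the named fact F-75c
`Literature.AlgebraicGeometry.Resolution.Stacks0BIC_embeddedResolutionCurvesInSurfaces_locus`
(`--supports stmt-ResolutionOfSingularities-15917 --as helper`). Printed (Tag 0BIC, proof ¶1): «Let `X' → X` be a
blowup in a closed point `p`. Then the inverse image `Z' ⊂ X'` of `Z` is supported on the strict transform of `Z` and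
the exceptional divisor. The exceptional divisor is a regular curve (Lemma 54.3.1) and the strict transform `Y'` of each
irreducible component `Y` is either equal to `Y` or the blowup of `Y` at `p`.»

A MEMBER (curve) of a configuration on a scheme `Y` is recorded as a closed subset `C = cl{η}` with `η` NOT a closed
point and `dim 𝒪_{Y,η} = 1` (a one-dimensional integral closed subset which is not an irreducible component; on a
Noetherian quasi-excellent `Y` of dimension `≤ 2` its reduced subscheme is an integral Noetherian quasi-excellent
scheme of dimension one — the member hypotheses of `false_of_badPointChain_of_curveConfiguration`). For the blowing up
`π : Y' → Y` of a closed point `x` with `𝒪_{Y,x}` regular of dimension `2`: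

* `member_props` — integrality / Noetherian / quasi-excellence / dimension one of the reduced subscheme of a member;
* `exceptional_isMember`, `isRegular_subscheme_exceptional`, `comap_vanishingIdeal_singleton_eq` — the exceptional
  curve `E = π⁻¹{x}` is a member, regular, and `𝓘_{x}·𝒪_{Y'} = 𝓘_E`;
* `strictTransform_isMember` — the strict transform `cl(π⁻¹(C ∖ {x}))` of a member is a member;
* `biUnion_successor_eq` — `⋃ (strict transforms) ∪ E = π⁻¹(⋃ 𝒞)` when `x ∈ ⋃ 𝒞`.

HONEST FRAMING: bookkeeping over tree theorems (exceptional fibre irreducible / non-trivial / regular; strict transforms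
off the centre). Nothing here is a statement of [Hironaka2017]. AI-written; AI review is weaker than expert review.
References: The Stacks Project, Tags 0BIC, 0AGR [StacksProject]; Q. Liu (2002), Thm. 8.1.19 [Liu2002].
-/

noncomputable section

set_option linter.dupNamespace false -- mandated namespace of this single-conjunct summit

open CategoryTheory AlgebraicGeometry TopologicalSpace IsLocalRing

namespace Summit.ResolutionOfSingularities.ResolutionOfSingularities.Theorems

namespace F75c

open Literature.AlgebraicGeometry.Resolution
open Summit.ResolutionOfSingularities.ResolutionOfSingularities.Theorems.CP2008Prop44
open Scheme.IdealSheafData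

universe u

/-! ## Members -/

section Members

variable {Y : Scheme.{u}}

/-- **`dim cl{η} = 1`** for a non-closed point `η` with one-dimensional local ring on a scheme of dimension `≤ 2`
(`dim cl{η} = height η`, `height + coheight ≤ 2`, `coheight η = dim 𝒪_{Y,η} = 1`, `height η ≥ 1`).
[cite: StacksProject, Tag 02I4] -/
theorem topologicalKrullDim_subscheme_closure_eq_one_of_dim_le_two (hY2 : topologicalKrullDim Y ≤ 2) {η : Y}
    (h1 : ringKrullDim (Y.presheaf.stalk η) = 1) (hcl : ¬ IsClosed ({η} : Set Y)) :
    topologicalKrullDim (vanishingIdeal (⟨closure {η}, isClosed_closure⟩ : Closeds Y)).subscheme = 1 := by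
  rw [topologicalKrullDim_subscheme_vanishingIdeal]
  change topologicalKrullDim (closure ({η} : Set Y)) = 1
  rw [topologicalKrullDim_closure_singleton_eq_height]
  have hcoh : Order.coheight η = 1 := by
    have h := ringKrullDim_stalk_eq_coheight η
    rw [h1] at h
    exact_mod_cast h.symm
  have hle : Order.height η + Order.coheight η ≤ 2 := by
    have := (coe_height_add_coheight_le_topologicalKrullDim η).trans hY2
    rwa [← WithBot.coe_ofNat, WithBot.coe_le_coe] at this
  rw [hcoh] at hle
  have hpos : 0 < Order.height η := by
    rw [Order.height_pos]
    intro hmin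
    apply hcl
    have hsub : closure ({η} : Set Y) ⊆ {η} := by
      intro z hz
      have hsp : η ⤳ z := specializes_iff_mem_closure.mpr hz
      have hle' : z ≤ η := Scheme.le_iff_specializes.mpr hsp
      have heq : η = z := (hsp.antisymm (Scheme.le_iff_specializes.mp (hmin hle'))).eq
      rw [Set.mem_singleton_iff, heq]
    rw [← closure_subset_iff_isClosed]
    exact hsub
  have hfin : Order.height η ≠ ⊤ := by
    intro h
    rw [h] at hle
    exact absurd hle (by decide)
  obtain ⟨k, hk⟩ := ENat.ne_top_iff_exists.mp hfin
  rw [← hk] at hle hpos ⊢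
  have h1' : k + 1 ≤ 2 := by exact_mod_cast hle
  have h2 : 0 < k := by exact_mod_cast hpos
  have hk1 : k = 1 := by omega
  subst hk1
  rfl

/-- **Member properties**: on a Noetherian quasi-excellent scheme of dimension `≤ 2`, the reduced subscheme of
`cl{η}` (`η` not closed, `dim 𝒪_{Y,η} = 1`) is integral, Noetherian, quasi-excellent and one-dimensional — the member
hypotheses of `false_of_badPointChain_of_curveConfiguration`. [cite: StacksProject, Tag 0BIC (Lemma 54.15.6, proof ¶1)] -/
theorem member_props [IsNoetherian Y] (hqe : Scheme.IsQuasiExcellent Y) (hY2 : topologicalKrullDim Y ≤ 2) {η : Y}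
    (h1 : ringKrullDim (Y.presheaf.stalk η) = 1) (hcl : ¬ IsClosed ({η} : Set Y)) :
    IsIntegral (vanishingIdeal (⟨closure {η}, isClosed_closure⟩ : Closeds Y)).subscheme ∧
      IsNoetherian (vanishingIdeal (⟨closure {η}, isClosed_closure⟩ : Closeds Y)).subscheme ∧
      Scheme.IsQuasiExcellent (vanishingIdeal (⟨closure {η}, isClosed_closure⟩ : Closeds Y)).subscheme ∧
      topologicalKrullDim (vanishingIdeal (⟨closure {η}, isClosed_closure⟩ : Closeds Y)).subscheme = 1 :=
  ⟨isIntegral_subscheme_closure η, isNoetherian_subscheme_closure η, isQuasiExcellent_subscheme_closure hqe η,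
    topologicalKrullDim_subscheme_closure_eq_one_of_dim_le_two hY2 h1 hcl⟩

/-- A closed point of a member is not its generic point, hence has a two-dimensional local ring on a scheme of
dimension `≤ 2` (`coheight x > coheight η = 1`). [cite: StacksProject, Tag 02I4] -/
theorem ringKrullDim_stalk_eq_two_of_mem_closure (hY2 : topologicalKrullDim Y ≤ 2) {η x : Y}
    (h1 : ringKrullDim (Y.presheaf.stalk η) = 1) (hx : IsClosed ({x} : Set Y)) (hcl : ¬ IsClosed ({η} : Set Y))
    (hxη : x ∈ closure ({η} : Set Y)) : ringKrullDim (Y.presheaf.stalk x) = 2 := by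
  have hne : η ≠ x := by rintro rfl; exact hcl hx
  have hsp : η ⤳ x := specializes_iff_mem_closure.mpr hxη
  have hcohη : Order.coheight η = 1 := by
    have h := ringKrullDim_stalk_eq_coheight η
    rw [h1] at h
    exact_mod_cast h.symm
  -- `x < η` in the specialisation order, so `coheight x ≥ coheight η + 1 = 2`
  have hlt : x < η := by
    refine lt_iff_le_not_ge.mpr ⟨Scheme.le_iff_specializes.mpr hsp, fun h => hne ?_⟩
    have hsp' : x ⤳ η := Scheme.le_iff_specializes.mp h
    have hmem : η ∈ closure ({x} : Set Y) := specializes_iff_mem_closure.mp hsp'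
    rw [hx.closure_eq, Set.mem_singleton_iff] at hmem
    exact hmem
  have h2 : (2 : ℕ∞) ≤ Order.coheight x := by
    have := Order.coheight_add_one_le hlt
    rw [hcohη] at this
    exact this
  have hle : Order.coheight x ≤ 2 := (topologicalKrullDim_le_iff_forall_coheight_le Y 2).mp hY2 x
  rw [ringKrullDim_stalk_eq_coheight x, le_antisymm hle h2]
  rfl

end Members

/-! ## The exceptional curve -/

section Exceptional

variable {Y Y' : Scheme.{u}} [IsLocallyNoetherian Y] {x : Y} {hx : IsClosed ({x} : Set Y)} {π : Y' ⟶ Y}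

/-- **`𝓘_{x}·𝒪_{Y'} = 𝓘_E`** with `E = π⁻¹{x}` (the reduced point is a regular centre on a regular scheme).
[cite: Liu2002, Thm. 8.1.19 (b)] -/
theorem comap_vanishingIdeal_singleton_eq (hreg : Scheme.IsRegular Y) (hπ : IsBlowup π (vanishingIdeal ⟨{x}, hx⟩)) :
    (vanishingIdeal ⟨{x}, hx⟩).comap π =
      vanishingIdeal ⟨π ⁻¹' {x}, hx.preimage π.continuous⟩ :=
  hπ.comap_vanishingIdeal_eq_vanishingIdeal_preimage hreg (D := ⟨{x}, hx⟩)
    (isRegular_subscheme_vanishingIdeal_singleton hx)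

/-- **The exceptional curve is regular** (its reduced subscheme). [cite: StacksProject, Tag 0AGR (Lemma 54.3.2)]
[cite: Liu2002, Thm. 8.1.19 (b)] -/
theorem isRegular_subscheme_exceptional (hreg : Scheme.IsRegular Y) (hπ : IsBlowup π (vanishingIdeal ⟨{x}, hx⟩)) :
    Scheme.IsRegular (vanishingIdeal (⟨π ⁻¹' {x}, hx.preimage π.continuous⟩ : Closeds Y')).subscheme := by
  rw [← comap_vanishingIdeal_singleton_eq hreg hπ]
  exact hπ.isRegular_subscheme_comap hreg (isRegular_subscheme_vanishingIdeal_singleton hx)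

/-- **The exceptional curve is a member**: `E = π⁻¹{x} = cl{η_E}` with `η_E` not closed and `dim 𝒪_{Y',η_E} = 1`
(`𝓘_E` is an effective Cartier divisor, so `𝔪_{η_E} = (𝓘_E)_{η_E}` is generated by one non-zero element of the regular
local ring `𝒪_{Y',η_E}`; `E` has at least two points as `dim 𝒪_{Y,x} = 2`). [cite: StacksProject, Tag 0AGQ (Lemma 54.3.1)]
[cite: Hartshorne1977, II Thm. 8.24 (b)] -/
theorem exceptional_isMember (hreg : Scheme.IsRegular Y) (hπ : IsBlowup π (vanishingIdeal ⟨{x}, hx⟩))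
    (hx2 : ringKrullDim (Y.presheaf.stalk x) = 2) :
    ∃ η : Y', π ⁻¹' {x} = closure {η} ∧ ¬ IsClosed ({η} : Set Y') ∧ ringKrullDim (Y'.presheaf.stalk η) = 1 := by
  haveI := hreg x
  have hst : stalkIdeal (vanishingIdeal ⟨{x}, hx⟩) x = maximalIdeal (Y.presheaf.stalk x) :=
    stalkIdeal_vanishingIdeal_singleton hx
  obtain ⟨η, x', hE, hx'E, hsp, hne⟩ :=
    hπ.exists_specializes_ne_of_mem_preimage x hst (by rw [hx2]) hx
  have hηcl : ¬ IsClosed ({η} : Set Y') := by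
    intro hcl
    have : x' ∈ closure ({η} : Set Y') := hE ▸ hx'E
    rw [hcl.closure_eq, Set.mem_singleton_iff] at this
    exact hne this
  refine ⟨η, hE, hηcl, ?_⟩
  -- the local ring at `η`: regular, maximal ideal = stalk of the (Cartier) exceptional ideal
  haveI : IsProper π := hπ.isProper
  haveI : IsLocallyNoetherian Y' := LocallyOfFiniteType.isLocallyNoetherian π
  have hreg' : Scheme.IsRegular Y' :=
    hπ.isRegular_of_isRegular_subscheme hreg (isRegular_subscheme_vanishingIdeal_singleton hx)
  haveI := hreg' η
  have hEcl : (⟨closure {η}, isClosed_closure⟩ : Closeds Y') = ⟨π ⁻¹' {x}, hx.preimage π.continuous⟩ :=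
    Closeds.ext hE.symm
  have hmax : stalkIdeal ((vanishingIdeal ⟨{x}, hx⟩).comap π) η = maximalIdeal (Y'.presheaf.stalk η) := by
    rw [comap_vanishingIdeal_singleton_eq hreg hπ, ← hEcl]
    exact stalkIdeal_vanishingIdeal_closure_self η
  obtain ⟨f, hf, hfspan⟩ := hπ.isEffectiveCartier.exists_stalkIdeal_eq_span η
  rw [hmax] at hfspan
  -- `𝔪 = (f)`, `f ≠ 0`: dimension one
  have hsf := IsRegularLocalRing.spanFinrank_maximalIdeal (R := Y'.presheaf.stalk η)
  have hle : ((maximalIdeal (Y'.presheaf.stalk η)).spanFinrank : WithBot ℕ∞) ≤ 1 := by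
    have h : (maximalIdeal (Y'.presheaf.stalk η)).spanFinrank ≤ ({f} : Set _).ncard := by
      rw [hfspan]; exact Submodule.spanFinrank_span_le_ncard_of_finite (Set.finite_singleton f)
    rw [Set.ncard_singleton] at h
    exact_mod_cast h
  rw [hsf] at hle
  have hne0 : maximalIdeal (Y'.presheaf.stalk η) ≠ ⊥ := by
    rw [hfspan, Ne, Ideal.span_singleton_eq_bot]
    exact nonZeroDivisors.ne_zero hf
  have hpos : (maximalIdeal (Y'.presheaf.stalk η)).spanFinrank ≠ 0 := by
    intro h0
    exact hne0 ((Submodule.spanFinrank_eq_zero_iff_eq_bot (IsNoetherian.noetherian _)).mp h0)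
  obtain ⟨d, hd⟩ := exists_nat_cast_eq_ringKrullDim (R := Y'.presheaf.stalk η)
  rw [hd] at hle hsf ⊢
  have h1 : d ≤ 1 := by exact_mod_cast hle
  have h2 : (maximalIdeal (Y'.presheaf.stalk η)).spanFinrank = d := by exact_mod_cast hsf
  have : d = 1 := by omega
  rw [this]; rfl

end Exceptional

/-! ## Strict transforms of members -/

section StrictTransform

variable {Y Y' : Scheme.{u}} [IsLocallyNoetherian Y] {x : Y} {hx : IsClosed ({x} : Set Y)} {π : Y' ⟶ Y}

/-- **The strict transform of a member is a member**: for `C = cl{η}` (`η` not closed, `dim 𝒪_{Y,η} = 1`) and the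
blowing up `π` of the closed point `x`, `cl(π⁻¹(C ∖ {x})) = cl{η'}` for the unique `η'` over `η`, which is not closed
and has `dim 𝒪_{Y',η'} = 1` (`π` is an isomorphism near `η'`). [cite: StacksProject, Tag 0BIC (Lemma 54.15.6, proof ¶1)]
[cite: GortzWedhorn2020, Prop. 13.91 (3)] -/
theorem strictTransform_isMember (hπ : IsBlowup π (vanishingIdeal ⟨{x}, hx⟩)) {η : Y}
    (h1 : ringKrullDim (Y.presheaf.stalk η) = 1) (hcl : ¬ IsClosed ({η} : Set Y)) :
    ∃ η' : Y', π η' = η ∧ closure (π ⁻¹' (closure ({η} : Set Y) \ {x})) = closure {η'} ∧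
      ¬ IsClosed ({η'} : Set Y') ∧ ringKrullDim (Y'.presheaf.stalk η') = 1 := by
  have hsupp : ((vanishingIdeal (⟨{x}, hx⟩ : Closeds Y)).support : Set Y) = {x} :=
    Scheme.IdealSheafData.coe_support_vanishingIdeal _
  have hηx : η ∉ ((vanishingIdeal (⟨{x}, hx⟩ : Closeds Y)).support : Set Y) := by
    rw [hsupp, Set.mem_singleton_iff]
    rintro rfl
    exact hcl hx
  obtain ⟨η', hη', -⟩ := hπ.existsUnique_preimage_of_not_mem_support hηx
  haveI := hπ.isIso_stalkMap_of_not_mem_support (x' := η') (by rw [hη']; exact hηx)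
  refine ⟨η', hη', ?_, ?_, ?_⟩
  · rw [← hsupp]
    exact hπ.closure_preimage_diff_support_eq_closure_singleton hη' hηx
  · intro hcl'
    haveI : IsProper π := hπ.isProper
    have himg : π '' ({η'} : Set Y') = {η} := by rw [Set.image_singleton, hη']
    exact hcl (himg ▸ (π.isClosedMap _ hcl'))
  · rw [← h1, ← hη']
    exact ringKrullDim_eq_of_ringEquiv (asIso (π.stalkMap η')).commRingCatIsoToRingEquiv.symm

omit [IsLocallyNoetherian Y] in
/-- **The union of the successor configuration**: if `x` lies on some member of `𝒞`, then
`⋃_{C ∈ 𝒞} cl(π⁻¹(C ∖ {x})) ∪ π⁻¹{x} = π⁻¹(⋃_{C ∈ 𝒞} C)`. [cite: StacksProject, Tag 0BIC (Lemma 54.15.6, proof ¶1)] -/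
theorem biUnion_strictTransform_union_exceptional_eq (π : Y' ⟶ Y) (𝒞 : Set (Closeds Y))
    (hx𝒞 : ∃ C ∈ 𝒞, x ∈ (C : Set Y)) :
    (⋃ C ∈ 𝒞, closure (π ⁻¹' ((C : Set Y) \ {x}))) ∪ π ⁻¹' {x} = π ⁻¹' (⋃ C ∈ 𝒞, (C : Set Y)) := by
  apply le_antisymm
  · apply Set.union_subset
    · exact Set.iUnion₂_subset fun C hC =>
        (closure_minimal (Set.preimage_mono Set.sdiff_subset) (C.isClosed.preimage π.continuous)).trans
          (Set.preimage_mono (Set.subset_biUnion_of_mem hC))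
    · obtain ⟨C, hC, hxC⟩ := hx𝒞
      exact (Set.preimage_mono (Set.singleton_subset_iff.mpr hxC)).trans
        (Set.preimage_mono (Set.subset_biUnion_of_mem hC))
  · intro q hq
    rw [Set.mem_preimage, Set.mem_iUnion₂] at hq
    obtain ⟨C, hC, hqC⟩ := hq
    by_cases hqx : π q = x
    · exact Or.inr hqx
    · exact Or.inl (Set.mem_iUnion₂.mpr ⟨C, hC, subset_closure ⟨hqC, hqx⟩⟩)

end StrictTransform

end F75c

end Summit.ResolutionOfSingularities.ResolutionOfSingularities.Theorems

end
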